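import Summits.QuantumFields.GaugeBoot.Rows.KZL2HD4EntChk1
import Summits.QuantumFields.GaugeBoot.Rows.KZL2HD4EntChk2
import Summits.QuantumFields.GaugeBoot.Rows.KZL2HD4EntChk3
import Summits.QuantumFields.GaugeBoot.Rows.KZL2HD4EntChk4
import Summits.QuantumFields.GaugeBoot.Rows.KZL2HD4EntChk5
import Summits.QuantumFields.GaugeBoot.Rows.KZL2HD4EntChk6
import Summits.QuantumFields.GaugeBoot.Rows.KZL2rpD4Red
import Summits.QuantumFields.GaugeBoot.Certificates.KZL2HD4Tab
import Summits.QuantumFields.GaugeBoot.Certificates.KZL2rpD4Tab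
import HarnessLib

/-!
# Gauge-boot: THE REDUCTION STEP (kz-L2-H-4D) — all 30 reduced positivity blocks are PSD for the torus state, by relabelling kz-L2-rp-4D

Cell `pub-gaugeboot`, seat lean1 — kz-L2-H-4D (`KZL2HD4`: SU(2), D = 4, Kazakov–Zheng Λ ≤ 2 hierarchy, Hermitian blocks only;
rows C61–C75 / C118–C122 of the CERTIFIED ledger) torus positivity layer, obtained by RELABELLING the landed kz-L2-rp-4D layer.

HONEST FRAMING (page 1 of every file of this cell): certified bounds on lattice expectations at STATED coupling,
gauge group, dimension and torus size; NOT a mass gap, NOT a continuum limit, NOT a string tension, NOT large `N`.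
The venture is explicitly NOT Yang–Mills-summit-bearing (barriers `FixedCouplingUltralocality`,
`PerturbativeInvisibility`).

`KZL2HD4.redBlock_posSemidef (hβ : 0 ≤ β) (hL : Even L) (hL6 : 6 ≤ L) : ∀ k : Fin 30, (Certificates.KZL2HD4.redBlock k (y β L)).PosSemidef`:
the `hpsd` hypothesis of lean3's kz-L2-H-4D certificate halves, DISCHARGED on the SU(2) torus state of every even `(ℤ/L)^4`, `L ≥ 6`.
Proof: lean3's kz-L2-H-4D block `k` evaluated at `y = KZL2rpD4.y ∘ emb` IS lean3's kz-L2-rp-4D block `k` (same index, `k < 30` = the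
Hermitian blocks `H/irrep…`) evaluated at `KZL2rpD4.y` — entrywise by the kernel checks `entChk_k` (`Rows/KZL2HD4EntChk*`) and
`evalComb_map_embPair` — so positivity is `KZL2rpD4.redBlock_posSemidef` (landed, p343678) transported along `Matrix.submatrix`.
No new positivity argument, no new expansion: the kz-L2-H-4D problem is the kz-L2-rp-4D problem with the reflection blocks dropped.
-/

noncomputable section

namespace Summit.QuantumFields.GaugeBoot

namespace KZL2HD4

open Matrix Summit.QuantumFields.GaugeBoot.Certificates Summit.QuantumFields.GaugeBoot.Certificates.Sparse

/-- Relabelling a combination along `emb` does not change its value: `evalComb L (y ∘ emb) = evalComb (L.map embPair) y`. -/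
theorem evalComb_map_embPair (y : Fin 10878 → ℝ) : ∀ L : List (ℕ × ℤ),
    evalComb L (fun v : Fin 2306 => y (embFin v)) = evalComb (L.map embPair) y
  | [] => by simp
  | (w, c) :: rest => by
      rw [List.map_cons, embPair, evalComb_cons, evalComb_cons, evalComb_map_embPair y rest]
      congr 1
      by_cases hw : w < 2306
      · have hw' : emb w < 10878 := (lt_iff_emb_lt w).1 hw
        rw [dif_pos hw, dif_pos hw']; rfl
      · have hw' : ¬ emb w < 10878 := fun h => hw ((lt_iff_emb_lt w).2 h)
        rw [dif_neg hw, dif_neg hw']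

/-- The kernel checks, gathered: for every block `k < 30` and `i, j < 30`. -/
theorem entChk (k : Fin 30) : ∀ i j : Fin 30,
    (Sparse.ent KZL2HD4.EB k.val i.val j.val).map embPair = Sparse.ent KZL2rpD4.EB k.val i.val j.val := by
  fin_cases k
  · exact entChk_0
  · exact entChk_1
  · exact entChk_2
  · exact entChk_3
  · exact entChk_4
  · exact entChk_5
  · exact entChk_6
  · exact entChk_7
  · exact entChk_8
  · exact entChk_9
  · exact entChk_10
  · exact entChk_11
  · exact entChk_12
  · exact entChk_13
  · exact entChk_14
  · exact entChk_15
  · exact entChk_16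
  · exact entChk_17
  · exact entChk_18
  · exact entChk_19
  · exact entChk_20
  · exact entChk_21
  · exact entChk_22
  · exact entChk_23
  · exact entChk_24
  · exact entChk_25
  · exact entChk_26
  · exact entChk_27
  · exact entChk_28
  · exact entChk_29

/-- Block dimensions agree: `KZL2HD4.dim k = KZL2rpD4.dim k` for `k < 30`. -/
theorem dim_eq (k : Fin 30) : KZL2HD4.dim k = KZL2rpD4.dim ⟨k.val, by omega⟩ := by
  fin_cases k <;> rfl

/-- Dimensions are at most 30. -/
theorem dim_le (k : Fin 30) : KZL2HD4.dim k ≤ 30 := by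
  fin_cases k <;> decide

/-- Index cast between the two copies of block `k`. -/
def castIdx (k : Fin 30) (i : Fin (KZL2HD4.dim k)) : Fin (KZL2rpD4.dim ⟨k.val, by omega⟩) := ⟨i.val, dim_eq k ▸ i.isLt⟩

/-- **lean3's kz-L2-H-4D block `k` at `y ∘ emb` is lean3's kz-L2-rp-4D block `k` at `y`** (as a submatrix along the index cast). -/
theorem redBlock_eq_submatrix (k : Fin 30) (y : Fin 10878 → ℝ) :
    KZL2HD4.redBlock k (fun v : Fin 2306 => y (embFin v)) =
      (KZL2rpD4.redBlock ⟨k.val, by omega⟩ y).submatrix (castIdx k) (castIdx k) := by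
  ext i j
  rw [Matrix.submatrix_apply, KZL2HD4.redBlock_apply, KZL2rpD4.redBlock_apply, KZL2HD4.ent, KZL2rpD4.ent,
    evalComb_map_embPair]
  have hi : i.val < 30 := lt_of_lt_of_le i.isLt (dim_le k)
  have hj : j.val < 30 := lt_of_lt_of_le j.isLt (dim_le k)
  have h := entChk k ⟨i.val, hi⟩ ⟨j.val, hj⟩
  simp only at h
  rw [h]; rfl

variable (β : ℝ) (L : ℕ) [NeZero L]

/-- **THE REDUCTION STEP (kz-L2-H-4D).** Every reduced positivity block of the kz-L2-H-4D problem files is PSD for the SU(2) torus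
state on every even `(ℤ/L)^4`, `L ≥ 6`, `0 ≤ β_std` — the `hpsd` hypothesis of lean3's `Certificates/KZL2HD4b<tag>{Up,Lo}`. -/
theorem redBlock_posSemidef (hβ : 0 ≤ β) (hL : Even L) (hL6 : 6 ≤ L) :
    ∀ k : Fin 30, (KZL2HD4.redBlock k (y β L)).PosSemidef := by
  intro k
  have h := KZL2rpD4.redBlock_posSemidef β L hβ hL hL6 ⟨k.val, by omega⟩
  have e : y β L = fun v => KZL2rpD4.y β L (embFin v) := rfl
  rw [e, redBlock_eq_submatrix]
  exact h.submatrix _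

end KZL2HD4

end Summit.QuantumFields.GaugeBoot

end
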